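import Mathlib.GroupTheory.SpecificGroups.Dihedral
import Mathlib.NumberTheory.Padics.RingHoms
import Mathlib.NumberTheory.Padics.ProperSpace
import Mathlib.Topology.MetricSpace.Ultra.TotallySeparated
import Mathlib.Topology.Instances.ZMod
import Mathlib.Topology.Algebra.Category.ProfiniteGrp.Basic
import Literature.AnabelianGeometry.EtaleTheta.SettingModelSemidirectTopology
import Literature.IUT.HodgeTheaters.PuncturedEllipticArrowModel
import HarnessLib

/-!
# An infinite pro-`l` model of [IUTchI] §1, part 1: the profinite group `ℤ_l^{ℤ/l} ⋊ (ℤ_l ⋊ ℤ/2)`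

Mochizuki, *Inter-universal Teichmüller theory I*, kurims manuscript (May 2020), §1 pp. 37–38
([IUTchI] §1 p.37) [claim: Mochizuki2012, status: disputed] (D-0012 claim key; series status DISPUTED —
this is a WITNESS-class MODEL module, plain profinite group theory; nothing of the series is asserted, no
side is taken on [IUTchIII] Cor. 3.12).

PURPOSE (abc-iut-L5-d4, node IUTchI:Cor1.2, row «COR12-NV-PROL»).  The binders `htf` («`Δ_X` is
torsion-free», [AbsTopII] Cor. 3.3 (ii)) and `hrank′` («`[Δ_X : Ker(Δ_X ↠ Δ_X^{ab} ⊗ ℤ/l)] = l²`») of the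
Layer-5 certificate row `layer5_held_cor12_v6` are FALSE at every model of the §1 interface whose geometric
part is finite (abc-iut-L5-t1's `ArrowModel`: torsion; index `l³`).  This file starts an INFINITE model with
torsion-free `Δ_X` of the printed `l`-rank: for a prime `l`, the abelianisation-over-`ℤ_l` of the genuine
picture `Δ_X = ⟨a, b⟩^∧ ⊃ Δ_X̲ = ⟨a^l, b, aba⁻¹, …⟩` — namely
`N := ⨁_{i ∈ ℤ/l} ℤ_l · B_i` (`B_i = a^i b a^{−i}`), `C := ⟨a⟩ ≅ ℤ_l` acting on `N` through
`C ↠ ℤ/l` by the cyclic shift, the involution `ι` acting by `a ↦ a⁻¹`, `B_m ↦ −B_{1−m}`, so that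
`Π_C := N ⋊ (C ⋊ ℤ/2)` acts on `N` through the finite dihedral group `D_l` EXACTLY by abc-iut-L5-t1's
formulas (`ArrowModel.rot/refl`, here with `ℤ_l`-coefficients and without the `A`-coordinate, which now
lives in `C` as `a^l`).  Contents: the coefficient module `V = (ℤ/l → ℤ_l)`, the `D_l`-action `dact` and
`φ_D : D_l → Aut(N)`, the inertia vectors `c_i := B_{i+1} − B_i` with `φ_d(c_i) = c_{d·i}`, the pro-`l`
dihedral group `D := ℤ_l ⋊ ℤ/2` with `D ↠ D_l`, the ambient `P := N ⋊ D`, and the PROFINITE TOPOLOGY on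
`D` and `P` (induced along `g ↦ (g.left, g.right)`, abc-iut-L2's `SettingModel.Semidirect` toolkit):
topological group, compact, Hausdorff, totally disconnected.  The subgroups `Π_X, Π_C̲`, the cusps and the
`PuncturedEllipticData` are the sequel.  Instances are declared only on the NEW carriers `D l`, `P l`.
HONEST LABEL: a semi-synthetic model (`G_k = 1` here) — consistency evidence for OUR typed binders, not
the fundamental group of a curve.  No `sorry`; symbolic prime `l`.
-/

noncomputable section

namespace Literature.IUT.HodgeTheaters

namespace PuncturedEllipticData

namespace ProLModel

open DihedralGroup _root_.Topology
open Literature.AnabelianGeometry.EtaleTheta.SettingModel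

variable (l : ℕ) [Fact l.Prime]

/-! ### The coefficient module `V = ⨁_{i ∈ ℤ/l} ℤ_l · B_i` and the `D_l`-action -/

/-- The `ℤ_l`-module `ℤ_l^{ℤ/l}` (coordinates `B_i`, `i ∈ ℤ/l`). [claim: Mochizuki2012, status: disputed] -/
abbrev V : Type := ZMod l → ℤ_[l]

/-- `N := ⨁_i ℤ_l · B_i`, written multiplicatively. [claim: Mochizuki2012, status: disputed] -/
abbrev N : Type := Multiplicative (V l)

/-- The basis vector `B_j`. [claim: Mochizuki2012, status: disputed] -/
def δ (j : ZMod l) : V l := Pi.single j 1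

/-- `δ_j(m) = 1` if `m = j`, else `0`. [claim: Mochizuki2012, status: disputed] -/
theorem δ_apply (j m : ZMod l) : δ l j m = if m = j then 1 else 0 := by
  unfold δ; rw [Pi.single_apply]

/-- The inertia generator of the cusp `i`: `c_i := B_{i+1} − B_i` (abelianised `a^i [a,b] a^{−i}`).
[claim: Mochizuki2012, status: disputed] -/
def cvec (i : ZMod l) : V l := δ l (i + 1) - δ l i

/-- `c_i(m) = [m = i+1] − [m = i]`. [claim: Mochizuki2012, status: disputed] -/
theorem cvec_apply (i m : ZMod l) :
    cvec l i m = (if m = i + 1 then 1 else 0) - (if m = i then 1 else 0) := by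
  unfold cvec; rw [Pi.sub_apply, δ_apply, δ_apply]

/-- The rotation `r_k`: `B_i ↦ B_{i+k}`, i.e. `f ↦ f(· − k)`. [claim: Mochizuki2012, status: disputed] -/
def rot (k : ZMod l) : V l ≃+ V l where
  toFun f m := f (m - k)
  invFun f m := f (m + k)
  left_inv f := by funext m; simp
  right_inv f := by funext m; simp
  map_add' f g := by funext m; simp

/-- The reflection `σ_k`: `B_m ↦ −B_{1−k−m}`, i.e. `f ↦ (m ↦ −f(1 − k − m))`. [claim: Mochizuki2012, status: disputed] -/
def refl (k : ZMod l) : V l ≃+ V l where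
  toFun f m := -f (1 - k - m)
  invFun f m := -f (1 - k - m)
  left_inv f := by funext m; simp only [neg_neg, sub_sub_cancel]
  right_inv f := by funext m; simp only [neg_neg, sub_sub_cancel]
  map_add' f g := by funext m; simp only [Pi.add_apply, neg_add]

/-- `rot k f` evaluated. [claim: Mochizuki2012, status: disputed] -/
@[simp] theorem rot_apply (k : ZMod l) (f : V l) (m : ZMod l) : rot l k f m = f (m - k) := rfl

/-- `refl k f` evaluated. [claim: Mochizuki2012, status: disputed] -/
@[simp] theorem refl_apply (k : ZMod l) (f : V l) (m : ZMod l) : refl l k f m = -f (1 - k - m) := rfl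

/-- The action of `D_l` on `V`: `r_k ↦ rot k`, `s r_k ↦ σ_k`. [claim: Mochizuki2012, status: disputed] -/
def dact : DihedralGroup l → V l ≃+ V l
  | r k => rot l k
  | sr k => refl l k

/-- [claim: Mochizuki2012, status: disputed] -/
@[simp] theorem dact_r (k : ZMod l) : dact l (r k) = rot l k := rfl

/-- [claim: Mochizuki2012, status: disputed] -/
@[simp] theorem dact_sr (k : ZMod l) : dact l (sr k) = refl l k := rfl

/-- The action is multiplicative (the dihedral relations hold for `rot`, `σ`). [claim: Mochizuki2012, status: disputed] -/
theorem dact_mul (d e : DihedralGroup l) (f : V l) : dact l (d * e) f = dact l d (dact l e f) := by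
  funext m
  cases d <;> cases e <;>
    simp only [r_mul_r, r_mul_sr, sr_mul_r, sr_mul_sr, dact_r, dact_sr, rot_apply, refl_apply, neg_neg]
    <;> congr 1 <;> ring

/-- Each `dact d` is continuous (coordinate permutations and negations). [claim: Mochizuki2012, status: disputed] -/
theorem continuous_dact (d : DihedralGroup l) : Continuous (dact l d) := by
  cases d with
  | r k => exact continuous_pi fun m => continuous_apply (m - k)
  | sr k => exact continuous_pi fun m => (continuous_apply (1 - k - m)).neg

/-- The action homomorphism `φ_D : D_l → Aut(N)`. [claim: Mochizuki2012, status: disputed] -/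
def phiD : DihedralGroup l →* MulAut (N l) where
  toFun d := AddEquiv.toMultiplicative (dact l d)
  map_one' := by
    refine MulEquiv.ext fun p => ?_
    change Multiplicative.ofAdd (dact l (r 0) (Multiplicative.toAdd p)) = p
    rw [dact_r]
    refine (congrArg Multiplicative.ofAdd ?_).trans (ofAdd_toAdd p)
    funext m; rw [rot_apply, sub_zero]
  map_mul' d e := by
    refine MulEquiv.ext fun p => ?_
    change Multiplicative.ofAdd (dact l (d * e) (Multiplicative.toAdd p)) =
      Multiplicative.ofAdd (dact l d (Multiplicative.toAdd
        (Multiplicative.ofAdd (dact l e (Multiplicative.toAdd p)))))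
    rw [toAdd_ofAdd, dact_mul]

/-- `toAdd (φ_D d n) = dact d (toAdd n)`. [claim: Mochizuki2012, status: disputed] -/
theorem toAdd_phiD_apply (d : DihedralGroup l) (n : N l) :
    Multiplicative.toAdd (phiD l d n) = dact l d (Multiplicative.toAdd n) := rfl

/-- `φ_D d (ofAdd v) = ofAdd (dact d v)`. [claim: Mochizuki2012, status: disputed] -/
theorem phiD_ofAdd (d : DihedralGroup l) (v : V l) :
    phiD l d (Multiplicative.ofAdd v) = Multiplicative.ofAdd (dact l d v) := rfl

/-! ### `φ_d(c_i) = c_{d·i}` (the cusp permutation is abc-iut-L5-t1's `ArrowModel.cuspAct`) -/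

/-- `rot k (c_i) = c_{i+k}`. [claim: Mochizuki2012, status: disputed] -/
theorem rot_cvec (k i : ZMod l) : rot l k (cvec l i) = cvec l (i + k) := by
  funext m
  simp only [rot_apply, cvec_apply]
  have h1 : (m - k = i + 1) ↔ (m = i + k + 1) :=
    ⟨fun h => by linear_combination h, fun h => by linear_combination h⟩
  have h2 : (m - k = i) ↔ (m = i + k) :=
    ⟨fun h => by linear_combination h, fun h => by linear_combination h⟩
  simp only [h1, h2]

/-- `σ_k (c_i) = c_{−k−i}`. [claim: Mochizuki2012, status: disputed] -/
theorem refl_cvec (k i : ZMod l) : refl l k (cvec l i) = cvec l (-k - i) := by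
  funext m
  simp only [refl_apply, cvec_apply]
  have h1 : (1 - k - m = i + 1) ↔ (m = -k - i) :=
    ⟨fun h => by linear_combination -h, fun h => by linear_combination -h⟩
  have h2 : (1 - k - m = i) ↔ (m = -k - i + 1) :=
    ⟨fun h => by linear_combination -h, fun h => by linear_combination -h⟩
  simp only [h1, h2]
  ring

/-- `φ_d(c_i) = c_{d·i}` for every `d ∈ D_l`, with abc-iut-L5-t1's cusp permutation `cuspAct`.
[claim: Mochizuki2012, status: disputed] -/
theorem dact_cvec (d : DihedralGroup l) (i : ZMod l) :
    dact l d (cvec l i) = cvec l (ArrowModel.cuspAct l d i) := by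
  cases d with
  | r k => rw [dact_r, rot_cvec, ArrowModel.cuspAct_r]
  | sr k => rw [dact_sr, refl_cvec, ArrowModel.cuspAct_sr]

/-! ### The pro-`l` dihedral group `D := ℤ_l ⋊ ℤ/2` and `D ↠ D_l` -/

/-- `C := ⟨a⟩ ≅ ℤ_l`, written multiplicatively. [claim: Mochizuki2012, status: disputed] -/
abbrev C : Type := Multiplicative ℤ_[l]

/-- `ℤ/2`, written multiplicatively (the involution `ι`). [claim: Mochizuki2012, status: disputed] -/
abbrev Z2 : Type := Multiplicative (ZMod 2)

/-- The exponent `t ↦ t.val ∈ {0, 1}` of an element of `ℤ/2`. [claim: Mochizuki2012, status: disputed] -/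
def expo (t : Z2) : ℕ := (Multiplicative.toAdd t).val

/-- `expo 1 = 0`. [claim: Mochizuki2012, status: disputed] -/
@[simp] theorem expo_one : expo (1 : Z2) = 0 := ZMod.val_zero

/-- `expo (t u) ≡ expo t + expo u (mod 2)`. [claim: Mochizuki2012, status: disputed] -/
theorem expo_mul (t u : Z2) : expo (t * u) = (expo t + expo u) % 2 := by
  unfold expo; rw [toAdd_mul, ZMod.val_add]

/-- Powers of an involution only depend on the exponent mod `2`. [claim: Mochizuki2012, status: disputed] -/
theorem pow_mod_two_of_sq {M : Type*} [Monoid M] {x : M} (hx : x ^ 2 = 1) (n : ℕ) :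
    x ^ (n % 2) = x ^ n := by
  conv_rhs => rw [← Nat.mod_add_div n 2, pow_add, pow_mul, hx, one_pow, mul_one]

/-- `ι` acts on `C` by inversion: `ψ : ℤ/2 → Aut(C)`, `t ↦ (x ↦ x⁻¹)^{t}`. [claim: Mochizuki2012, status: disputed] -/
def psi : Z2 →* MulAut (C l) where
  toFun t := MulEquiv.inv (C l) ^ expo t
  map_one' := by rw [expo_one, pow_zero]
  map_mul' t u := by
    have h2 : MulEquiv.inv (C l) ^ 2 = 1 := by
      ext x; simp [pow_two]
    rw [expo_mul, pow_mod_two_of_sq h2, pow_add]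

/-- `ψ t x = x` or `x⁻¹` according to the exponent of `t`. [claim: Mochizuki2012, status: disputed] -/
theorem psi_apply (t : Z2) (x : C l) : psi l t x = if expo t = 0 then x else x⁻¹ := by
  have ht : expo t < 2 := (Multiplicative.toAdd t).val_lt
  change (MulEquiv.inv (C l) ^ expo t) x = _
  interval_cases h : expo t
  · rw [pow_zero]; rfl
  · rw [pow_one]; rfl

/-- **`D := C ⋊ ℤ/2 = ℤ_l ⋊ ℤ/2`**, the pro-`l` dihedral group `⟨a, ι | ι a ι = a⁻¹⟩^∧`.
[claim: Mochizuki2012, status: disputed] -/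
abbrev D : Type := C l ⋊[psi l] Z2

/-- `C → D_l`, `a^s ↦ r_{s mod l}`. [claim: Mochizuki2012, status: disputed] -/
def rotOf : C l →* DihedralGroup l where
  toFun s := r (PadicInt.toZMod (Multiplicative.toAdd s))
  map_one' := by rw [toAdd_one, map_zero, r_zero]
  map_mul' s u := by rw [toAdd_mul, map_add, r_mul_r]

/-- `rotOf (a^s) = r_{s mod l}`. [claim: Mochizuki2012, status: disputed] -/
theorem rotOf_apply (s : C l) : rotOf l s = r (PadicInt.toZMod (Multiplicative.toAdd s)) := rfl

/-- `ℤ/2 → D_l`, `ι^t ↦ (s r_0)^t`. [claim: Mochizuki2012, status: disputed] -/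
def reflOf : Z2 →* DihedralGroup l where
  toFun t := sr 0 ^ expo t
  map_one' := by rw [expo_one, pow_zero]
  map_mul' t u := by
    have h2 : (sr 0 : DihedralGroup l) ^ 2 = 1 := by rw [pow_two, sr_mul_sr, sub_self, r_zero]
    rw [expo_mul, pow_mod_two_of_sq h2, pow_add]

/-- `reflOf (ι^t) = (s r_0)^t`. [claim: Mochizuki2012, status: disputed] -/
theorem reflOf_apply (t : Z2) : reflOf l t = sr 0 ^ expo t := rfl

/-- Compatibility `rotOf (ψ_t s) = reflOf t · rotOf s · (reflOf t)⁻¹` (`s r_0 · r_k · s r_0 = r_{−k}`).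
[claim: Mochizuki2012, status: disputed] -/
theorem rotOf_psi (t : Z2) (s : C l) :
    rotOf l (psi l t s) = reflOf l t * rotOf l s * (reflOf l t)⁻¹ := by
  have ht : expo t < 2 := (Multiplicative.toAdd t).val_lt
  rw [psi_apply, reflOf_apply, rotOf_apply, rotOf_apply]
  interval_cases h : expo t
  · simp
  · simp only [one_ne_zero, ↓reduceIte, toAdd_inv, map_neg, pow_one, inv_sr, sr_mul_r, sr_mul_sr,
      zero_add, zero_sub]

/-- **`D ↠ D_l`**: `(a^s, ι^t) ↦ r_{s mod l} · (s r_0)^t`. [claim: Mochizuki2012, status: disputed] -/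
def toDih : D l →* DihedralGroup l :=
  SemidirectProduct.lift (rotOf l) (reflOf l) fun t => MonoidHom.ext fun s => rotOf_psi l t s

/-- `toDih (a^s, ι^t) = r_{s mod l} · (s r_0)^t`. [claim: Mochizuki2012, status: disputed] -/
theorem toDih_apply (g : D l) :
    toDih l g = r (PadicInt.toZMod (Multiplicative.toAdd g.left)) * sr 0 ^ expo g.right := rfl

/-- The action of `D` on `N`, through `D ↠ D_l`. [claim: Mochizuki2012, status: disputed] -/
def phi : D l →* MulAut (N l) := (phiD l).comp (toDih l)

/-- `toAdd (φ g n) = dact (toDih g) (toAdd n)`. [claim: Mochizuki2012, status: disputed] -/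
theorem toAdd_phi_apply (g : D l) (n : N l) :
    Multiplicative.toAdd (phi l g n) = dact l (toDih l g) (Multiplicative.toAdd n) := rfl

/-- **`P := N ⋊ D`** — the ambient group `Π_C` of the model. [claim: Mochizuki2012, status: disputed] -/
abbrev P : Type := N l ⋊[phi l] D l

/-! ### The profinite topology on `D` and `P` -/

/-- Reduction `ℤ_l → ℤ/l` is locally constant (fibres are open unit balls). [folklore] -/
private theorem isLocallyConstant_toZMod :
    IsLocallyConstant (PadicInt.toZMod : ℤ_[l] → ZMod l) := by
  refine (IsLocallyConstant.iff_isOpen_fiber).mpr fun c => ?_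
  rw [isOpen_iff_mem_nhds]
  intro x hx
  have hx' : PadicInt.toZMod x = c := hx
  refine Filter.mem_of_superset (Metric.ball_mem_nhds x one_pos) fun y hy => ?_
  change PadicInt.toZMod y ∈ ({c} : Set (ZMod l))
  rw [Set.mem_singleton_iff, ← hx', ← sub_eq_zero, ← map_sub, ← RingHom.mem_ker,
    PadicInt.ker_toZMod, IsLocalRing.mem_maximalIdeal, PadicInt.mem_nonunits, ← dist_eq_norm]
  exact hy

/-- The topology of `D`: induced along `g ↦ (g.left, g.right) ∈ ℤ_l × ℤ/2`. [claim: Mochizuki2012, status: disputed] -/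
instance instTopologicalSpaceD : TopologicalSpace (D l) :=
  TopologicalSpace.induced (fun g : D l => (g.left, g.right)) inferInstance

/-- `g ↦ (g.left, g.right)` is inducing on `D`. [claim: Mochizuki2012, status: disputed] -/
theorem isInducing_D : IsInducing fun g : D l => (g.left, g.right) := ⟨rfl⟩

/-- The inversion action `ℤ/2 × C → C` is jointly continuous. [claim: Mochizuki2012, status: disputed] -/
theorem continuous_psi : Continuous fun q : Z2 × C l => psi l q.1 q.2 := by
  haveI : DiscreteTopology Z2 := inferInstanceAs (DiscreteTopology (ZMod 2))
  refine continuous_prod_of_discrete_left.mpr fun t => ?_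
  have ht : expo t < 2 := (Multiplicative.toAdd t).val_lt
  change Continuous fun x : C l => (MulEquiv.inv (C l) ^ expo t) x
  interval_cases h : expo t
  · simp only [pow_zero, MulAut.one_apply]; exact continuous_id
  · simp only [pow_one, MulEquiv.inv_apply]; exact continuous_inv

/-- `D` is a topological group. [claim: Mochizuki2012, status: disputed] -/
instance instIsTopologicalGroupD : IsTopologicalGroup (D l) :=
  Semidirect.isTopologicalGroup_of_continuous_action (isInducing_D l) (continuous_psi l)

/-- `D` is compact. [claim: Mochizuki2012, status: disputed] -/
instance instCompactSpaceD : CompactSpace (D l) := by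
  haveI : CompactSpace (C l) := inferInstanceAs (CompactSpace ℤ_[l])
  exact Semidirect.compactSpace_of (isInducing_D l)

/-- `D` is Hausdorff. [claim: Mochizuki2012, status: disputed] -/
instance instT2SpaceD : T2Space (D l) := by
  haveI : T2Space (C l) := inferInstanceAs (T2Space ℤ_[l])
  exact Semidirect.t2Space_of (isInducing_D l)

/-- `D` is totally disconnected. [claim: Mochizuki2012, status: disputed] -/
instance instTotallyDisconnectedSpaceD : TotallyDisconnectedSpace (D l) := by
  haveI : TotallyDisconnectedSpace (C l) := inferInstanceAs (TotallyDisconnectedSpace ℤ_[l])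
  haveI : DiscreteTopology Z2 := inferInstanceAs (DiscreteTopology (ZMod 2))
  exact Semidirect.totallyDisconnectedSpace_of (isInducing_D l)

/-- `D ↠ D_l` is locally constant (continuous for the discrete topology on `D_l`). [claim: Mochizuki2012, status: disputed] -/
theorem isLocallyConstant_toDih : IsLocallyConstant (toDih l) := by
  haveI : DiscreteTopology Z2 := inferInstanceAs (DiscreteTopology (ZMod 2))
  have hF : IsLocallyConstant fun q : C l × Z2 =>
      r (PadicInt.toZMod (Multiplicative.toAdd q.1)) * sr 0 ^ expo q.2 := by
    letI : TopologicalSpace (DihedralGroup l) := ⊥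
    haveI : DiscreteTopology (DihedralGroup l) := ⟨rfl⟩
    rw [IsLocallyConstant.iff_continuous]
    refine continuous_prod_of_discrete_right.mpr fun t => ?_
    have h1 : Continuous fun s : C l => r (PadicInt.toZMod (Multiplicative.toAdd s)) :=
      (IsLocallyConstant.iff_continuous _).1
        (((isLocallyConstant_toZMod l).comp_continuous continuous_toAdd).comp r)
    change Continuous fun s : C l => r (PadicInt.toZMod (Multiplicative.toAdd s)) * sr 0 ^ expo t
    exact h1.mul continuous_const
  have hfun : (toDih l : D l → DihedralGroup l) =
      (fun q : C l × Z2 => r (PadicInt.toZMod (Multiplicative.toAdd q.1)) * sr 0 ^ expo q.2) ∘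
        fun g : D l => (g.left, g.right) := funext (toDih_apply l)
  rw [hfun]
  exact hF.comp_continuous (isInducing_D l).continuous

/-- The topology of `P`: induced along `g ↦ (g.left, g.right) ∈ N × D`. [claim: Mochizuki2012, status: disputed] -/
instance instTopologicalSpaceP : TopologicalSpace (P l) :=
  TopologicalSpace.induced (fun g : P l => (g.left, g.right)) inferInstance

/-- `g ↦ (g.left, g.right)` is inducing on `P`. [claim: Mochizuki2012, status: disputed] -/
theorem isInducing_P : IsInducing fun g : P l => (g.left, g.right) := ⟨rfl⟩

/-- The action `D × N → N` is jointly continuous (it factors through the finite `D_l`). [claim: Mochizuki2012, status: disputed] -/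
theorem continuous_phi : Continuous fun q : D l × N l => phi l q.1 q.2 := by
  letI : TopologicalSpace (DihedralGroup l) := ⊥
  haveI : DiscreteTopology (DihedralGroup l) := ⟨rfl⟩
  have h1 : Continuous fun q : D l × N l => (toDih l q.1, q.2) :=
    (((IsLocallyConstant.iff_continuous _).1 (isLocallyConstant_toDih l)).comp continuous_fst).prodMk
      continuous_snd
  have h2 : Continuous fun q : DihedralGroup l × N l => phiD l q.1 q.2 := by
    refine continuous_prod_of_discrete_left.mpr fun d => ?_
    exact continuous_ofAdd.comp ((continuous_dact l d).comp continuous_toAdd)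
  exact h2.comp h1

/-- `P` is a topological group. [claim: Mochizuki2012, status: disputed] -/
instance instIsTopologicalGroupP : IsTopologicalGroup (P l) :=
  Semidirect.isTopologicalGroup_of_continuous_action (isInducing_P l) (continuous_phi l)

/-- `P` is compact. [claim: Mochizuki2012, status: disputed] -/
instance instCompactSpaceP : CompactSpace (P l) := by
  haveI : CompactSpace (N l) := inferInstanceAs (CompactSpace (ZMod l → ℤ_[l]))
  exact Semidirect.compactSpace_of (isInducing_P l)

/-- `P` is Hausdorff. [claim: Mochizuki2012, status: disputed] -/
instance instT2SpaceP : T2Space (P l) := by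
  haveI : T2Space (N l) := inferInstanceAs (T2Space (ZMod l → ℤ_[l]))
  exact Semidirect.t2Space_of (isInducing_P l)

/-- `P` is totally disconnected. [claim: Mochizuki2012, status: disputed] -/
instance instTotallyDisconnectedSpaceP : TotallyDisconnectedSpace (P l) := by
  haveI : TotallyDisconnectedSpace (N l) := inferInstanceAs (TotallyDisconnectedSpace (ZMod l → ℤ_[l]))
  exact Semidirect.totallyDisconnectedSpace_of (isInducing_P l)

/-- `g ↦ g.left` and `g ↦ g.right` are continuous on `P`. [claim: Mochizuki2012, status: disputed] -/
theorem continuous_left_right_P :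
    Continuous (fun g : P l => g.left) ∧ Continuous (fun g : P l => g.right) :=
  ⟨Semidirect.continuous_left (isInducing_P l), Semidirect.continuous_right (isInducing_P l)⟩

/-- `inl : N → P` and `inr : D → P` are continuous. [claim: Mochizuki2012, status: disputed] -/
theorem continuous_inl_inr_P :
    Continuous (SemidirectProduct.inl : N l → P l) ∧ Continuous (SemidirectProduct.inr : D l → P l) :=
  ⟨Semidirect.continuous_inl (isInducing_P l), Semidirect.continuous_inr (isInducing_P l)⟩

/-- **`Π_C` of the model as a profinite group.** [claim: Mochizuki2012, status: disputed] -/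
abbrev arithGrp : ProfiniteGrp.{0} := ProfiniteGrp.of (P l)

end ProLModel

end PuncturedEllipticData

end Literature.IUT.HodgeTheaters
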